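import Literature.Analysis.TotalPositivity.PolyaFrequencyProductEstimates
import Mathlib.Data.Fin.Tuple.Sort
import HarnessLib

/-!
# Compactness of square-summable root configurations (Schoenberg 1951, necessity half, step N4b)

Trunk `Literature/Analysis/TotalPositivity`, sixteenth proofs file accompanying
`PolyaFrequencyFunctions.lean` (the named fact `schoenberg1951_pf_laplace`).  Elementary
bookkeeping for the Laguerre–Pólya limit: a finite real family can be rearranged so that the
absolute values decrease (`exists_perm_antitone_abs`); for such a family with `Σ a_i² ≤ S` one has
`a_i² ≤ S/(i+1)` (`sq_le_div_of_antitone`); a uniformly bounded family of real sequences has a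
pointwise convergent subsequence (`exists_diagonal_subseq`, Tychonoff); and sums of squares are
lower semicontinuous under pointwise convergence (`summable_sq_of_tendsto`, Fatou).
[Schoenberg1951, §9; folklore]

## References

* I. J. Schoenberg, *On Pólya frequency functions. I*, J. Analyse Math. 1 (1951) 331–374, §9.
  [Schoenberg1951]
-/

noncomputable section

open Filter Set Finset
open scoped Topology

namespace Literature.Analysis.TotalPositivity

/-! ### Decreasing rearrangement -/

/-- A finite real family can be permuted so that `|a_i|` is non-increasing. [folklore] -/
theorem exists_perm_antitone_abs {n : ℕ} (a : Fin n → ℝ) :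
    ∃ σ : Equiv.Perm (Fin n), Antitone fun i => |a (σ i)| := by
  refine ⟨Tuple.sort fun i => -|a i|, fun i j hij => ?_⟩
  have h := Tuple.monotone_sort (fun i => -|a i|) hij
  simp only [Function.comp_apply] at h
  linarith

/-- The zero-padding vanishes beyond `n`. [folklore] -/
theorem pad_apply_of_le {n : ℕ} (a : Fin n → ℝ) {i : ℕ} (hi : n ≤ i) :
    (fun j : ℕ => if h : j < n then a ⟨j, h⟩ else 0) i = 0 := by
  simp [not_lt.2 hi]

/-- Sums over `Fin n` are sums of the zero-padding over `range n`. [folklore] -/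
theorem sum_pad_eq {M : Type*} [AddCommMonoid M] {n : ℕ} (a : Fin n → ℝ) (g : ℝ → M) :
    ∑ i ∈ Finset.range n, g ((fun j : ℕ => if h : j < n then a ⟨j, h⟩ else 0) i) = ∑ i, g (a i) := by
  rw [← Fin.sum_univ_eq_sum_range]
  refine Finset.sum_congr rfl fun i _ => ?_
  simp [i.isLt]

/-- Products over `Fin n` are products of the zero-padding over `range n`. [folklore] -/
theorem prod_pad_eq {M : Type*} [CommMonoid M] {n : ℕ} (a : Fin n → ℝ) (g : ℝ → M) :
    ∏ i ∈ Finset.range n, g ((fun j : ℕ => if h : j < n then a ⟨j, h⟩ else 0) i) = ∏ i, g (a i) := by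
  rw [← Fin.prod_univ_eq_prod_range]
  refine Finset.prod_congr rfl fun i _ => ?_
  simp [i.isLt]

/-- The zero-padding of an `|·|`-antitone family is `|·|`-antitone. [folklore] -/
theorem antitone_abs_pad {n : ℕ} {a : Fin n → ℝ} (ha : Antitone fun i => |a i|) :
    Antitone fun i : ℕ => |(fun j : ℕ => if h : j < n then a ⟨j, h⟩ else 0) i| := by
  intro i j hij
  by_cases hj : j < n
  · have hi : i < n := lt_of_le_of_lt hij hj
    simp only [hj, hi, dif_pos]
    exact ha (show (⟨i, hi⟩ : Fin n) ≤ ⟨j, hj⟩ from hij)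
  · simp only [hj, dif_neg, not_false_eq_true, abs_zero]
    exact abs_nonneg _

/-! ### The bound `a_i² ≤ S/(i+1)` -/

/-- For an `|·|`-antitone sequence vanishing from `N` on with `Σ_{i<N} a_i² ≤ S`:
`a_i² ≤ S/(i+1)`. [folklore] -/
theorem sq_le_div_of_antitone {u : ℕ → ℝ} (hu : Antitone fun i => |u i|) {N : ℕ} {S : ℝ}
    (hS : ∑ i ∈ Finset.range N, u i ^ 2 ≤ S) (hz : ∀ i, N ≤ i → u i = 0) (i : ℕ) :
    u i ^ 2 ≤ S / (i + 1) := by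
  have hS0 : 0 ≤ S := le_trans (Finset.sum_nonneg fun j _ => sq_nonneg (u j)) hS
  have hi1 : (0 : ℝ) < i + 1 := by positivity
  rw [le_div_iff₀ hi1]
  rcases le_or_gt N i with hNi | hNi
  · rw [hz i hNi]
    simpa using hS0
  · calc u i ^ 2 * (i + 1) = ∑ j ∈ Finset.range (i + 1), u i ^ 2 := by
          rw [Finset.sum_const, Finset.card_range]
          simp [mul_comm]
      _ ≤ ∑ j ∈ Finset.range (i + 1), u j ^ 2 := by
          refine Finset.sum_le_sum fun j hj => ?_
          simp only [Finset.mem_range] at hj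
          have h := hu (Nat.lt_succ_iff.1 hj)
          simp only at h
          rw [← sq_abs (u i), ← sq_abs (u j)]
          exact pow_le_pow_left₀ (abs_nonneg _) h 2
      _ ≤ ∑ j ∈ Finset.range N, u j ^ 2 :=
          Finset.sum_le_sum_of_subset_of_nonneg (Finset.range_mono (by omega))
            fun j _ _ => sq_nonneg (u j)
      _ ≤ S := hS

/-- The same bound for `|a_i|`. [folklore] -/
theorem abs_le_sqrt_div_of_antitone {u : ℕ → ℝ} (hu : Antitone fun i => |u i|) {N : ℕ} {S : ℝ}
    (hS : ∑ i ∈ Finset.range N, u i ^ 2 ≤ S) (hz : ∀ i, N ≤ i → u i = 0) (i : ℕ) :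
    |u i| ≤ Real.sqrt (S / (i + 1)) := by
  rw [← Real.sqrt_sq_eq_abs]
  exact Real.sqrt_le_sqrt (sq_le_div_of_antitone hu hS hz i)

/-- A uniform bound: `|a_i| ≤ √S`. [folklore] -/
theorem abs_le_sqrt_of_sum_sq_le {u : ℕ → ℝ} {N : ℕ} {S : ℝ}
    (hS : ∑ i ∈ Finset.range N, u i ^ 2 ≤ S) (hz : ∀ i, N ≤ i → u i = 0) (i : ℕ) :
    |u i| ≤ Real.sqrt S := by
  rw [← Real.sqrt_sq_eq_abs]
  refine Real.sqrt_le_sqrt ?_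
  rcases le_or_gt N i with hNi | hNi
  · rw [hz i hNi]
    simpa using le_trans (Finset.sum_nonneg fun j _ => sq_nonneg (u j)) hS
  · calc u i ^ 2 ≤ ∑ j ∈ Finset.range N, u j ^ 2 :=
          Finset.single_le_sum (f := fun j => u j ^ 2) (fun j _ => sq_nonneg (u j))
            (Finset.mem_range.2 hNi)
      _ ≤ S := hS

/-! ### Diagonal subsequences -/

/-- **Diagonal subsequence** (Tychonoff): a uniformly bounded family of real sequences has a
subsequence converging in every coordinate. [folklore] -/
theorem exists_diagonal_subseq {x : ℕ → ℕ → ℝ} {R : ℝ} (hx : ∀ n i, |x n i| ≤ R) :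
    ∃ (φ : ℕ → ℕ) (δ : ℕ → ℝ), StrictMono φ ∧
      ∀ i, Tendsto (fun l => x (φ l) i) atTop (𝓝 (δ i)) := by
  have hK : IsCompact (Set.pi Set.univ fun _ : ℕ => Set.Icc (-R) R) :=
    isCompact_univ_pi fun _ => isCompact_Icc
  obtain ⟨δ, -, φ, hφ, hlim⟩ := hK.tendsto_subseq (x := x)
    (fun n => Set.mem_univ_pi.2 fun i => abs_le.1 (hx n i))
  exact ⟨φ, δ, hφ, fun i => (tendsto_pi_nhds.1 hlim) i⟩

/-! ### Fatou for sums of squares -/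

/-- Sums over `range I` of a row vanishing from `N` on are dominated by the sum over `range N`.
[folklore] -/
theorem sum_range_sq_le_of_vanish {u : ℕ → ℝ} {N : ℕ} (hz : ∀ i, N ≤ i → u i = 0) (I : ℕ) :
    ∑ i ∈ Finset.range I, u i ^ 2 ≤ ∑ i ∈ Finset.range N, u i ^ 2 := by
  have h1 : ∑ i ∈ Finset.range I, u i ^ 2 ≤ ∑ i ∈ Finset.range (max I N), u i ^ 2 :=
    Finset.sum_le_sum_of_subset_of_nonneg (Finset.range_mono (le_max_left _ _))
      fun j _ _ => sq_nonneg (u j)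
  have h2 : ∑ i ∈ Finset.range (max I N), u i ^ 2 = ∑ i ∈ Finset.range N, u i ^ 2 := by
    refine (Finset.sum_subset (Finset.range_mono (le_max_right _ _)) fun j _ hj => ?_).symm
    simp only [Finset.mem_range, not_lt] at hj
    rw [hz j hj]
    ring
  exact h1.trans h2.le

/-- **Fatou for sums of squares**: if the rows `x_l` vanish from `N_l` on, converge pointwise to
`δ`, and `Σ_{i<N_l} x_{l,i}² → B`, then `Σ δ_i²` converges and is `≤ B`. [folklore] -/
theorem summable_sq_of_tendsto {x : ℕ → ℕ → ℝ} {δ : ℕ → ℝ} {N : ℕ → ℕ} {B : ℝ}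
    (hlim : ∀ i, Tendsto (fun l => x l i) atTop (𝓝 (δ i)))
    (hz : ∀ l i, N l ≤ i → x l i = 0)
    (hB : Tendsto (fun l => ∑ i ∈ Finset.range (N l), x l i ^ 2) atTop (𝓝 B)) :
    Summable (fun i => δ i ^ 2) ∧ ∑' i, δ i ^ 2 ≤ B := by
  have hpart : ∀ I, ∑ i ∈ Finset.range I, δ i ^ 2 ≤ B := by
    intro I
    have h1 : Tendsto (fun l => ∑ i ∈ Finset.range I, x l i ^ 2) atTop
        (𝓝 (∑ i ∈ Finset.range I, δ i ^ 2)) :=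
      tendsto_finsetSum _ fun i _ => (hlim i).pow 2
    exact le_of_tendsto_of_tendsto' h1 hB fun l => sum_range_sq_le_of_vanish (hz l) I
  have hsum : Summable fun i => δ i ^ 2 :=
    summable_of_sum_range_le (fun i => sq_nonneg (δ i)) hpart
  exact ⟨hsum, Real.tsum_le_of_sum_range_le (fun i => sq_nonneg (δ i)) hpart⟩

end Literature.Analysis.TotalPositivity
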